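import Literature.AnabelianGeometry.EtaleTheta.Discharge.Sec3Cor38iiOfInputs
import Literature.AnabelianGeometry.EtaleTheta.Discharge.Sec3Cor38BaseSquaresFSMFF
import Literature.AnabelianGeometry.EtaleTheta.Discharge.Sec3Cor38iiiOfIsFrobenioidWeak
import Literature.AnabelianGeometry.EtaleTheta.Discharge.Sec3Cor38CriterionCoordWeak
import Literature.AnabelianGeometry.EtaleTheta.Discharge.Sec3Cor38HullObjectsWeak
import Literature.AlgebraicGeometry.Frobenioids.Cor411iiOfPreStepsWeak
import Literature.AlgebraicGeometry.Frobenioids.EquivalencePreStepsFSMFF2008Assembly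
import HarnessLib

/-!
# [EtTh] Corollary 3.8 (ii) AS TYPED over the WEAK canonical monoid vocabulary (tempered coverings with infinitely
# many special-fibre components): [FrdI] Cor. 4.11 (ii) for `Ψ`, `Ψ⁻¹` DISCHARGED there, the base squares, and the
# node closer with only print-level clauses left

S. Mochizuki, *The étale theta function and its Frobenioid-theoretic manifestations*, Publ. RIMS **45** (2009),
Cor. 3.8 (ii), statement PDF p. 80, proof PDF p. 81 l. 5–8 ("By applying … [Mzk17], Theorem 3.4, (ii); [Mzk17],
Corollary 4.11, (ii), in the case of assertion (ii), it follows that `Ψ` preserves the submonoids '`O^▷(−)`'") and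
p. 81 l. 33 – p. 82 l. 5 [cite: MochizukiEtTh2009, Cor 3.8 p.81]; Def. 3.6 (i)/(ii) pp. 76–77, Rmk. 3.3.1 p. 73,
Rmk. 3.6.3 p. 79.  [Mzk17] = S. Mochizuki, *The geometry of Frobenioids I*, Kyushu J. Math. **62** (2008), Cor. 4.11 (ii)
p. 91 [cite: MochizukiFrdI2008, Cor. 4.11 (ii) p.91], Def. 2.4 (i) pp. 47–48, Thm. 3.4 (ii) p. 62.

abc-iut cell, layer L2 consumer knit written by the L1 seat abc-iut-L1-t12 (gen 6; offered on STATUS 11:16:25Z with first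
refusal to the L2 holders — composition only, nothing of abc-iut-L2-d2 / w6-d039 / w6-d040 / f-001 / w4-d084 / w5-d135
re-derived), cone node `EtTh:Cor3.8(ii)` (kernel id `N_EtTh_Cor3_8_ii`).  PROOF-ONLY (0 definitions).

WHY.  Cell finding F-L2d2-1 (abc-iut-L2-d2, `FrdIVocabularyWeak.lean`): at a connected tempered covering whose
`Δ^fil`-closures have INFINITELY MANY special-fibre components (`Ÿ`, `Z_∞` — where [EtTh] §§4–5 and [IUTchI] Ex. 3.2
work), `Φ₀(Y^log) ⊇ ∏_j ℤ_{≥0}` is NOT perf-factorial as printed ([FrdI] Def. 2.4 (i)(d) fails), so Def. 3.6 (ii)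
"perf-factorial" must be READ there as `IsPerfFactorialCof` — the vocabulary `treeMonoidVocabWeak`.  Every Cor. 3.8 (ii)
closer in the tree so far (abc-iut-w6-d040's `cor38_ii_canonical*`, `cor38_ii_of_criterion_tree`, f-001's base squares
`Sec3Cor38BaseSquaresTreeVocab/FSMFF`) lives at the STRONG vocabulary `treeMonoidVocab`, because its input [FrdI]
Cor. 4.11 (ii) was typed over `Objectwise IsPerfFactorial` only.  The L1 chain now exists over `IsPerfFactorialWeak`
(`PreFrobenioid.cor411ii_of_preservesPreSteps_of_not_isOfGroupLikeType_weak`, `Cor411iiOfPreStepsWeak.lean`, p440209;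
apex `FrdI.cor411ii_ofFunctor_weak`, p440557), and Cor. 3.8 (i)/(iii) have weak-vocabulary closers (abc-iut-w6-d039
`Sec3Cor38iWeak`, abc-iut-L2-d2 `Sec3Cor38iiiOfIsFrobenioidWeak`).  THIS FILE supplies the (ii) closers.

§1 (WEAK monoid vocabulary `treeMonoidVocabWeak`, ANY category vocabularies; `h : Cor38Hyp C₁ C₂`):
* `Cor38Hyp.cor411ii_of_isFrobenioid_weak` / `…_symm_…` — **[FrdI] Cor. 4.11 (ii) AS TYPED for `Ψ` and `Ψ⁻¹`,
  modulo ONLY `hF_i` ([FrdI] Thm. 5.2 (ii))**: pre-steps (C38-L02a, abc-iut-L2-d2's `preservesPreSteps_of_isFrobenioid_weak`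
  = [FrdI] Thm. 3.4 (ii) as printed over `h.fsmff`), "`Φ_i` weakly perf-factorial" (`objectwise_isPerfFactorialWeak_weak`),
  "not of group-like type" (Thm. 3.7 (i)), "`(C_i^istr)^pf` / its birationalization are Frobenioids" ([FrdI] Prop. 3.2
  (iii) `isFrobenioid_perfection_istr`; Prop. 4.4 (ii) 2024 form `isFrobenioid_birat_perfection_istr` from birationally
  Frobenius-normalized type — `Φ_i` divisorial (`objectwise_isDivisorial_weak`), `B_i` group-like) — f-001's strong
  derivation verbatim with the weak L1 closer;
* `baseSquare_of_isFrobenioid_weak` / `baseSquareInv_…` (rows F-2813/F-2814: the `1`-unique `Ψ^Base`, `(Ψ⁻¹)^Base`, for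
  Div-slim `D_i` — Cor. 3.8 (ii)'s hypothesis), `preservesOTri_of_isFrobenioid_of_isDivSlim_weak` (row F-2812, CASE (ii)
  as printed), `preservesFrobeniusTrivial_of_isFrobenioid_of_isDivSlim_weak` (row C38-L09), `preservesLinear_of_isFrobenioid_weak`
  (row F-2815), `preservesBsFldPreSteps_of_isFrobenioid_of_criteria_weak` (row F-2816 / C38-L06, criteria as binders)
  — via abc-iut-w6-d040's vocabulary-generic `_of_fact` rows with `h34 := FrdI.Thm34ii_holds` (F-0711 PROVED);
* `Cor38Hyp.cor38_ii_weak_of_criteria` — **the typed `Cor38_ii` (vocabulary parameter := [FrdI] Def. 4.5 (iv) read on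
  `(E, Φ)`, as in `cor38_ii_of_criterion_tree`) modulo `hF_i`, the criterion C38-L05 at THE perfections `h5_i` and
  [EtTh] Rmk. 3.6.3 `hR_i` ONLY** — C38-L01 unconditional (abc-iut-L2-d2), Cor. 4.11 (ii) discharged (§1), the object
  clause of Rmk. 3.6.3 a theorem (`hullEssImageObjClause_holds_weak`, abc-iut-w6-d040 lineage);
* `Cor38Hyp.cor38_ii_weak_of_coord` — `h5_i` ⟸ abc-iut-w4-d084's `bsFldPreStepLimitCriterion_of_coordWeak` (print-level
  clauses `hP34Λ_i` Prop. 3.4 (ii), `hNZ_i` Def. 3.6 (ii)(b), `hQ_i` Rmk. 3.3.1 / GAP G-w4d084-3) and `hR_i` ⟸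
  abc-iut-w5-d135's `remark363_of_isSharp` (`hP34Λ_i`, `hFinv_i` = Def. 3.6 (ii)(b)/(iii) "`F₀^Λ` stable under inverse";
  sharpness from weakly perf-factorial ⟹ divisorial).
§2 (weak monoid vocabulary, canonical category vocabulary `treeCatVocab`): `cor38_ii_weak_canonical_of_coord` — `hF_i` ⟸
the L2 standing residual `hBmon_i` ([FrdI] Thm. 5.2 (ii), `isFrobenioid_treeCatVocab_of_isMonoidOn`).

HONEST FRAMING: refereed pre-IUT material ([EtTh] §3 over [FrdI] §§3–4); no definition; no statement of either paper
restated or strengthened (`hNZ`, `hQ`, `hFinv`, `hP34Λ` are print's standing situation for the geometric data, kept as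
named binders exactly as in the strong-vocabulary closers); nothing here bears on [IUTchIII] Cor. 3.12; no side taken;
typed ≠ proved — here PROVED modulo the displayed named binders.
-/

namespace Literature.AnabelianGeometry.EtaleTheta

open CategoryTheory Opposite Literature.AlgebraicGeometry.Frobenioids

universe u₀ v₀ u v w

/-! ## §1 Weak monoid vocabulary, any category vocabularies -/

namespace Cor38Hyp

section TreeMonoidVocabWeak

variable {D₀ : Type u₀} [Category.{v₀} D₀] {D₀' : Type u₀} [Category.{v₀} D₀']
  {T : RealifiedDivisorMonoids (D₀ := D₀) treeMonoidVocabWeak.{w}}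
  {T' : RealifiedDivisorMonoids (D₀ := D₀') treeMonoidVocabWeak.{w}}
  {D : Type u} [Category.{v} D] {D' : Type u} [Category.{v} D']
  {VD : FrdICatStub.{u, v, w} D} {VD' : FrdICatStub.{u, v, w} D'}
  {C₁ : TemperedFrobenioid T D VD} {C₂ : TemperedFrobenioid T' D' VD'} (h : Cor38Hyp C₁ C₂)

open TemperedFrobenioid

/-- **[FrdI] Cor. 4.11 (ii) AS TYPED for `Ψ`, over the WEAK monoid vocabulary (any category vocabulary), modulo ONLY
`hF₁`, `hF₂`** ([FrdI] Thm. 5.2 (ii)) — case (ii) of C38-L04, p.81 l.5–8 "[Mzk17], Theorem 3.4, (ii); [Mzk17], Corollary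
4.11, (ii)": abc-iut-L1-t12's base-free WEAK closer `cor411ii_of_preservesPreSteps_of_not_isOfGroupLikeType_weak` fed with
pre-step preservation (C38-L02a, `preservesPreSteps_of_isFrobenioid_weak`), "`Φ_i` weakly perf-factorial"
(`objectwise_isPerfFactorialWeak_weak`), "not of group-like type" (Thm. 3.7 (i)), "`(C_i^istr)^pf` is a Frobenioid"
([FrdI] Prop. 3.2 (iii)) and "its birationalization is a Frobenioid" ([FrdI] Prop. 4.4 (ii), 2024 form, from birationally
Frobenius-normalized type: `Φ_i` divisorial, `B_i` group-like). [cite: MochizukiEtTh2009, Cor 3.8 p.81] -/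
theorem cor411ii_of_isFrobenioid_weak (hF₁ : PreFrobenioid.IsFrobenioid C₁.toElem)
    (hF₂ : PreFrobenioid.IsFrobenioid C₂.toElem) : C₁.opsData.Cor411ii C₂.opsData h.Ψ := by
  have hps : h.PreservesPreSteps := h.preservesPreSteps_of_isFrobenioid_weak hF₁ hF₂
  have hPf₁ := PreFrobenioid.isFrobenioid_perfection_istr hF₁
  have hPf₂ := PreFrobenioid.isFrobenioid_perfection_istr hF₂
  have hnb₁ := ModelFrobenioid.isOfBiratFrobeniusNormalizedType_of_isDivisorial hF₁
    (PreFrobenioid.hasBiratSquares_of_isFrobenioid hF₁) C₁.objectwise_isDivisorial_weak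
    (C₁.ratFnFunctor_isGroupLike T.isUnit_BΛ)
  have hnb₂ := ModelFrobenioid.isOfBiratFrobeniusNormalizedType_of_isDivisorial hF₂
    (PreFrobenioid.hasBiratSquares_of_isFrobenioid hF₂) C₂.objectwise_isDivisorial_weak
    (C₂.ratFnFunctor_isGroupLike T'.isUnit_BΛ)
  exact PreFrobenioid.cor411ii_of_preservesPreSteps_of_not_isOfGroupLikeType_weak hF₁ hF₂ h.Ψ
    C₁.objectwise_isPerfFactorialWeak_weak C₂.objectwise_isPerfFactorialWeak_weak hps.1 hps.2
    C₁.opsData_not_isOfGroupLikeType C₂.opsData_not_isOfGroupLikeType hPf₁ hPf₂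
    (PreFrobenioid.isFrobenioid_birat_perfection_istr hF₁ hnb₁ hPf₁)
    (PreFrobenioid.isFrobenioid_birat_perfection_istr hF₂ hnb₂ hPf₂)

/-- The same for `Ψ⁻¹`. [cite: MochizukiEtTh2009, Cor 3.8 p.81] -/
theorem cor411ii_symm_of_isFrobenioid_weak (hF₁ : PreFrobenioid.IsFrobenioid C₁.toElem)
    (hF₂ : PreFrobenioid.IsFrobenioid C₂.toElem) : C₂.opsData.Cor411ii C₁.opsData h.Ψ.symm := by
  have hps : h.PreservesPreSteps := h.preservesPreSteps_of_isFrobenioid_weak hF₁ hF₂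
  have hPf₁ := PreFrobenioid.isFrobenioid_perfection_istr hF₁
  have hPf₂ := PreFrobenioid.isFrobenioid_perfection_istr hF₂
  have hnb₁ := ModelFrobenioid.isOfBiratFrobeniusNormalizedType_of_isDivisorial hF₁
    (PreFrobenioid.hasBiratSquares_of_isFrobenioid hF₁) C₁.objectwise_isDivisorial_weak
    (C₁.ratFnFunctor_isGroupLike T.isUnit_BΛ)
  have hnb₂ := ModelFrobenioid.isOfBiratFrobeniusNormalizedType_of_isDivisorial hF₂
    (PreFrobenioid.hasBiratSquares_of_isFrobenioid hF₂) C₂.objectwise_isDivisorial_weak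
    (C₂.ratFnFunctor_isGroupLike T'.isUnit_BΛ)
  exact PreFrobenioid.cor411ii_of_preservesPreSteps_of_not_isOfGroupLikeType_weak hF₂ hF₁ h.Ψ.symm
    C₂.objectwise_isPerfFactorialWeak_weak C₁.objectwise_isPerfFactorialWeak_weak hps.2 hps.1
    C₂.opsData_not_isOfGroupLikeType C₁.opsData_not_isOfGroupLikeType hPf₂ hPf₁
    (PreFrobenioid.isFrobenioid_birat_perfection_istr hF₂ hnb₂ hPf₂)
    (PreFrobenioid.isFrobenioid_birat_perfection_istr hF₁ hnb₁ hPf₁)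

/-- **Row F-2813 over the weak monoid vocabulary under print's exact hypothesis** (Cor. 3.8 (ii): "`D_i` … Div-slim
[relative to `Φ_i`]"): the `1`-unique `Ψ^Base : D₁ → D₂` of [FrdI] Cor. 4.11 (ii) under `Ψ`, modulo `hF_i` (C38-L01
unconditional at the weak vocabulary, abc-iut-L2-d2; hypothesis (b) vacuous). [cite: MochizukiEtTh2009, Cor 3.8 p.81] -/
theorem baseSquare_of_isFrobenioid_weak (hF₁ : PreFrobenioid.IsFrobenioid C₁.toElem)
    (hF₂ : PreFrobenioid.IsFrobenioid C₂.toElem) (hds : C₁.opsData.IsDivSlim ∧ C₂.opsData.IsDivSlim) :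
    h.BaseSquare :=
  h.baseSquare_of_cor411ii (h.cor411ii_of_isFrobenioid_weak hF₁ hF₂) hds
    h.standardIsotropicNotGroupLike_treeMonoidVocabWeak (fun h₁ _ => absurd h₁ C₁.opsData_not_isOfGroupLikeType)

/-- **Row F-2814 over the weak monoid vocabulary**: the `1`-unique `(Ψ⁻¹)^Base : D₂ → D₁`, for `D₁`, `D₂` Div-slim;
modulo `hF_i`. [cite: MochizukiEtTh2009, Cor 3.8 p.81] -/
theorem baseSquareInv_of_isFrobenioid_weak (hF₁ : PreFrobenioid.IsFrobenioid C₁.toElem)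
    (hF₂ : PreFrobenioid.IsFrobenioid C₂.toElem) (hds : C₁.opsData.IsDivSlim ∧ C₂.opsData.IsDivSlim) :
    h.BaseSquareInv :=
  h.baseSquareInv_of_cor411ii (h.cor411ii_symm_of_isFrobenioid_weak hF₁ hF₂) hds
    h.standardIsotropicNotGroupLike_treeMonoidVocabWeak (fun h₂ _ => absurd h₂ C₂.opsData_not_isOfGroupLikeType)

/-- **Row F-2812 / C38-L04, CASE (ii) EXACTLY AS PRINTED, over the weak monoid vocabulary** ("Suppose … `D_i` … is
Div-slim … `Ψ` preserves the submonoids '`O^▷(−)`'", pp.80–81): `Ψ` and `Ψ⁻¹` preserve `O^▷(−)` = base-identity linear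
endomorphisms — abc-iut-w6-d040's vocabulary-generic `preservesOTri_of_fact` with `h34 := FrdI.Thm34ii_holds` (F-0711,
PROVED) and the two weak Cor. 4.11 (ii) conclusions; modulo `hF_i`. [cite: MochizukiEtTh2009, Cor 3.8 p.81] -/
theorem preservesOTri_of_isFrobenioid_of_isDivSlim_weak (hF₁ : PreFrobenioid.IsFrobenioid C₁.toElem)
    (hF₂ : PreFrobenioid.IsFrobenioid C₂.toElem) (hds : C₁.opsData.IsDivSlim ∧ C₂.opsData.IsDivSlim) :
    h.PreservesOTri :=
  h.preservesOTri_of_fact FrdI.Thm34ii_holds hF₁ hF₂ h.standardIsotropicNotGroupLike_treeMonoidVocabWeak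
    (h.cor411ii_of_isFrobenioid_weak hF₁ hF₂) (h.cor411ii_symm_of_isFrobenioid_weak hF₁ hF₂) hds

/-- **Row C38-L09 over the weak monoid vocabulary** (p.82 l.1: "under the assumptions of assertion (ii), `Ψ` preserves
… the Frobenius-trivial objects"): for `Ψ` and `Ψ⁻¹`, `D_i` Div-slim — w6-d040's `preservesFrobeniusTrivial_of_fact` with
`h34 := FrdI.Thm34ii_holds` and the weak Cor. 4.11 (ii) base squares; modulo `hF_i`. [cite: MochizukiEtTh2009, Cor 3.8 p.82] -/
theorem preservesFrobeniusTrivial_of_isFrobenioid_of_isDivSlim_weak (hF₁ : PreFrobenioid.IsFrobenioid C₁.toElem)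
    (hF₂ : PreFrobenioid.IsFrobenioid C₂.toElem) (hds : C₁.opsData.IsDivSlim ∧ C₂.opsData.IsDivSlim) :
    h.PreservesFrobeniusTrivial :=
  h.preservesFrobeniusTrivial_of_fact FrdI.Thm34ii_holds hF₁ hF₂ h.standardIsotropicNotGroupLike_treeMonoidVocabWeak
    (h.cor411ii_of_isFrobenioid_weak hF₁ hF₂) (h.cor411ii_symm_of_isFrobenioid_weak hF₁ hF₂) hds

/-- **Row F-2815 over the weak monoid vocabulary** ("`Ψ` preserves linear morphisms", the degree half of "`Ψ` preserves
`O^▷(−)`", p.81; [FrdI] Thm. 3.4 (iii)) for `Ψ` and `Ψ⁻¹`, modulo `hF_i` — w6-d040's `thm34iii_of_fact` with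
`h34 := FrdI.Thm34ii_holds`, (a) = C38-L01 unconditional, (b) vacuous. [cite: MochizukiEtTh2009, Cor 3.8 p.81] -/
theorem preservesLinear_of_isFrobenioid_weak (hF₁ : PreFrobenioid.IsFrobenioid C₁.toElem)
    (hF₂ : PreFrobenioid.IsFrobenioid C₂.toElem) : h.PreservesLinear :=
  h.preservesLinear_of_thm34iii (h.thm34iii_of_fact FrdI.Thm34ii_holds hF₁ hF₂)
    (h.thm34iii_symm_of_fact FrdI.Thm34ii_holds hF₁ hF₂) h.standardIsotropicNotGroupLike_treeMonoidVocabWeak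
    (h.hypB_of_standardIsotropicNotGroupLike h.standardIsotropicNotGroupLike_treeMonoidVocabWeak)
    (h.hypB_symm_of_standardIsotropicNotGroupLike h.standardIsotropicNotGroupLike_treeMonoidVocabWeak)

/-- **Row F-2816 / C38-L06 over the weak monoid vocabulary** (p.81 l.14–15: "Thus, `Ψ` preserves the base-field-theoretic
pre-steps"), for Div-slim `D_i`, modulo `hF_i` and the criterion C38-L05 at THE perfections on both sides — w6-d040's
`preservesBsFldPreSteps_of_fact` (w5-d124's transport, all four `Ψ^pf`-transports discharged) with `h34 := FrdI.Thm34ii_holds`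
and the weak Cor. 4.11 (ii) conclusions. [cite: MochizukiEtTh2009, Cor 3.8 p.81] -/
theorem preservesBsFldPreSteps_of_isFrobenioid_of_criteria_weak (hF₁ : PreFrobenioid.IsFrobenioid C₁.toElem)
    (hF₂ : PreFrobenioid.IsFrobenioid C₂.toElem) (hds : C₁.opsData.IsDivSlim ∧ C₂.opsData.IsDivSlim)
    (h5₁ : C₁.BsFldPreStepLimitCriterion (PreFrobenioidData.perfection hF₁))
    (h5₂ : C₂.BsFldPreStepLimitCriterion (PreFrobenioidData.perfection hF₂)) : h.PreservesBsFldPreSteps :=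
  h.preservesBsFldPreSteps_of_fact FrdI.Thm34ii_holds hF₁ hF₂ h.standardIsotropicNotGroupLike_treeMonoidVocabWeak
    (h.cor411ii_of_isFrobenioid_weak hF₁ hF₂) (h.cor411ii_symm_of_isFrobenioid_weak hF₁ hF₂) hds h5₁ h5₂

/-- **[EtTh] Cor. 3.8 (ii) AS TYPED over the WEAK monoid vocabulary (any category vocabulary), with abc-iut-L2-t3's
vocabulary parameter `IsDivSlim (E) (Φ)` := [FrdI] Def. 4.5 (iv) read on `(E, Φ)`** (the literal body of L1's
`PreFrobenioidData.IsDivSlim`; bridge `⟨·⟩`, as in `cor38_ii_of_criterion_tree`) — modulo ONLY `hF_i` ([FrdI] Thm. 5.2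
(ii)), the criterion C38-L05 at THE perfections `h5_i` and [EtTh] Rmk. 3.6.3 `hR_i` (F-0581): [FrdI] Thm. 3.4 (ii)
`FrdI.Thm34ii_holds` (F-0711 PROVED), C38-L01 unconditional (abc-iut-L2-d2), [FrdI] Cor. 4.11 (ii) for `Ψ`, `Ψ⁻¹`
DISCHARGED over weakly perf-factorial `Φ_i` (abc-iut-L1-t12), the object clause of Rmk. 3.6.3 a theorem
(`hullEssImageObjClause_holds_weak`); knit = abc-iut-w6-d040's `cor38_ii_of_criterion`.
[cite: MochizukiEtTh2009, Cor 3.8 p.81] -/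
theorem cor38_ii_weak_of_criteria (hF₁ : PreFrobenioid.IsFrobenioid C₁.toElem)
    (hF₂ : PreFrobenioid.IsFrobenioid C₂.toElem)
    (h5₁ : C₁.BsFldPreStepLimitCriterion (PreFrobenioidData.perfection hF₁))
    (h5₂ : C₂.BsFldPreStepLimitCriterion (PreFrobenioidData.perfection hF₂))
    (hR₁ : C₁.Remark363) (hR₂ : C₂.Remark363) :
    Literature.AnabelianGeometry.EtaleTheta.Cor38_ii
      (fun E _ Φ => ∀ (A : E) (α : Aut (Over.forget A)),
        (∀ (B : Over A) (x : Φ.obj (op B.left)),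
          Literature.AlgebraicGeometry.Frobenioids.pull Φ (α.hom.app B) x = x) → α = 1) h :=
  h.cor38_ii_of_criterion _ (fun hd => ⟨hd⟩) (fun hd' => ⟨hd'⟩) FrdI.Thm34ii_holds hF₁ hF₂
    h.standardIsotropicNotGroupLike_treeMonoidVocabWeak (h.cor411ii_of_isFrobenioid_weak hF₁ hF₂)
    (h.cor411ii_symm_of_isFrobenioid_weak hF₁ hF₂) h5₁ h5₂ hR₁ hR₂ C₁.hullEssImageObjClause_holds_weak
    C₂.hullEssImageObjClause_holds_weak

/-- **[EtTh] Cor. 3.8 (ii) AS TYPED over the WEAK monoid vocabulary, every interface-level binder consumed from its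
landed producer**, so that the inputs are PRINT-LEVEL CLAUSES on the Def. 3.3 / 3.6 data, per side: `hF_i` ([FrdI]
Thm. 5.2 (ii)); `hP34Λ_i` (Prop. 3.4 (ii) at monoid type `Λ`: a Laurent-constant whose `Λ`-divisor is effective lies in
`F₀^Λ`); `hNZ_i` (Def. 3.6 (ii)(b): a non-zero effective divisor of constants at every object); `hQ_i` (Rmk. 3.3.1 for
monoids of effective `ℤ`-divisors: every localized perfection `Φ_i(W)^pf_𝔮` is `ℚ`-monoprime — cell GAP G-w4d084-3);
`hFinv_i` (Def. 3.6 (ii)(b)/(iii): `F₀^Λ` is stable under inverse) — C38-L05 by abc-iut-w4-d084's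
`bsFldPreStepLimitCriterion_of_coordWeak`, Rmk. 3.6.3 by abc-iut-w5-d135's `remark363_of_isSharp` (sharpness: weakly
perf-factorial ⟹ divisorial). [cite: MochizukiEtTh2009, Cor 3.8 p.81] -/
theorem cor38_ii_weak_of_coord (hF₁ : PreFrobenioid.IsFrobenioid C₁.toElem)
    (hF₂ : PreFrobenioid.IsFrobenioid C₂.toElem)
    -- side 1: Prop. 3.4 (ii), Def. 3.6 (ii)(b), Rmk. 3.3.1, Def. 3.6 (iii)
    (hP34Λ₁ : ∀ (Y : D₀ᵒᵖ) (b : T.BΛ.obj Y) (r : T.ΦR.obj Y),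
      T.divΛ Y b = Algebra.GrothendieckGroup.of r → b ∈ T.FΛ Y)
    (hNZ₁ : ∀ A : Dᵒᵖ, ∃ u : (T.BΛ.obj (C₁.baseOp A) : Type w) × Algebra.GrothendieckGroup (C₁.Φ.carrier A),
      u ∈ C₁.cnstFn A ∧ ∃ Z : C₁.Φ.carrier A, Z ≠ 1 ∧ u.2 = Algebra.GrothendieckGroup.of Z)
    (hQ₁ : ∀ (W : D) (𝔮 : Primes (Perfection (C₁.divisorMonoid.obj (op W)))),
      IsQMonoprime (PfAt (C₁.divisorMonoid.obj (op W)) 𝔮))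
    (hFinv₁ : ∀ (Y : D₀ᵒᵖ) (b : T.BΛ.obj Y), b ∈ T.FΛ Y → ∃ b' ∈ T.FΛ Y, b' * b = 1)
    -- side 2
    (hP34Λ₂ : ∀ (Y : D₀'ᵒᵖ) (b : T'.BΛ.obj Y) (r : T'.ΦR.obj Y),
      T'.divΛ Y b = Algebra.GrothendieckGroup.of r → b ∈ T'.FΛ Y)
    (hNZ₂ : ∀ A : D'ᵒᵖ, ∃ u : (T'.BΛ.obj (C₂.baseOp A) : Type w) × Algebra.GrothendieckGroup (C₂.Φ.carrier A),
      u ∈ C₂.cnstFn A ∧ ∃ Z : C₂.Φ.carrier A, Z ≠ 1 ∧ u.2 = Algebra.GrothendieckGroup.of Z)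
    (hQ₂ : ∀ (W : D') (𝔮 : Primes (Perfection (C₂.divisorMonoid.obj (op W)))),
      IsQMonoprime (PfAt (C₂.divisorMonoid.obj (op W)) 𝔮))
    (hFinv₂ : ∀ (Y : D₀'ᵒᵖ) (b : T'.BΛ.obj Y), b ∈ T'.FΛ Y → ∃ b' ∈ T'.FΛ Y, b' * b = 1) :
    Literature.AnabelianGeometry.EtaleTheta.Cor38_ii
      (fun E _ Φ => ∀ (A : E) (α : Aut (Over.forget A)),
        (∀ (B : Over A) (x : Φ.obj (op B.left)),
          Literature.AlgebraicGeometry.Frobenioids.pull Φ (α.hom.app B) x = x) → α = 1) h :=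
  h.cor38_ii_weak_of_criteria hF₁ hF₂ (C₁.bsFldPreStepLimitCriterion_of_coordWeak hF₁ hP34Λ₁ hNZ₁ hQ₁)
    (C₂.bsFldPreStepLimitCriterion_of_coordWeak hF₂ hP34Λ₂ hNZ₂ hQ₂)
    (C₁.remark363_of_isSharp (fun A => (C₁.objectwise_isDivisorial_weak A).isSharp) hP34Λ₁ hFinv₁)
    (C₂.remark363_of_isSharp (fun A => (C₂.objectwise_isDivisorial_weak A).isSharp) hP34Λ₂ hFinv₂)

end TreeMonoidVocabWeak

/-! ## §2 Weak monoid vocabulary, canonical category vocabulary `treeCatVocab`: `IsFrobenioid` from `hBmon` -/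

section TreeCatVocabWeak

variable {D₀ : Type u₀} [Category.{v₀} D₀] {D₀' : Type u₀} [Category.{v₀} D₀']
  {T : RealifiedDivisorMonoids (D₀ := D₀) treeMonoidVocabWeak.{w}}
  {T' : RealifiedDivisorMonoids (D₀ := D₀') treeMonoidVocabWeak.{w}}
  {D : Type u} [Category.{v} D] {D' : Type u} [Category.{v} D']
  {IsRational IsStrictlyRational : (Dᵒᵖ ⥤ CommMonCat.{w}) → Prop}
  {IsRational' IsStrictlyRational' : (D'ᵒᵖ ⥤ CommMonCat.{w}) → Prop}
  {C₁ : TemperedFrobenioid T D (treeCatVocab D IsRational IsStrictlyRational)}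
  {C₂ : TemperedFrobenioid T' D' (treeCatVocab D' IsRational' IsStrictlyRational')} (h : Cor38Hyp C₁ C₂)

open TemperedFrobenioid

/-- **Rows F-2813 / F-2814 / F-2812 (case (ii)) at the canonical category vocabulary over the WEAK monoid vocabulary,
modulo `hBmon_i : IsMonoidOn B_i` ONLY** ("`𝔹` a monoid on `D`": then `C_i → F_{Φ_i}` IS a Frobenioid, [FrdI] Thm. 5.2
(ii), `isFrobenioid_treeCatVocab_of_isMonoidOn`), for Div-slim `D_i`: the two base squares and the preservation of
`O^▷(−)`. [cite: MochizukiEtTh2009, Cor 3.8 p.81] -/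
theorem baseSquares_and_preservesOTri_treeCatVocab_of_isMonoidOn_weak (hBmon₁ : IsMonoidOn C₁.ratFnFunctor)
    (hBmon₂ : IsMonoidOn C₂.ratFnFunctor) (hds : C₁.opsData.IsDivSlim ∧ C₂.opsData.IsDivSlim) :
    h.BaseSquare ∧ h.BaseSquareInv ∧ h.PreservesOTri :=
  have hF₁ := C₁.isFrobenioid_treeCatVocab_of_isMonoidOn hBmon₁
  have hF₂ := C₂.isFrobenioid_treeCatVocab_of_isMonoidOn hBmon₂
  ⟨h.baseSquare_of_isFrobenioid_weak hF₁ hF₂ hds, h.baseSquareInv_of_isFrobenioid_weak hF₁ hF₂ hds,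
    h.preservesOTri_of_isFrobenioid_of_isDivSlim_weak hF₁ hF₂ hds⟩

/-- **[EtTh] Cor. 3.8 (ii) AS TYPED at the canonical category vocabulary over the WEAK monoid vocabulary — `hF_i` ⟸
abc-iut-L2's standing residual `hBmon_i` ([FrdI] Thm. 5.2 (ii))**; otherwise the print-level clauses of
`cor38_ii_weak_of_coord`, per side. [cite: MochizukiEtTh2009, Cor 3.8 p.81] -/
theorem cor38_ii_weak_canonical_of_coord (hBmon₁ : IsMonoidOn C₁.ratFnFunctor) (hBmon₂ : IsMonoidOn C₂.ratFnFunctor)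
    (hP34Λ₁ : ∀ (Y : D₀ᵒᵖ) (b : T.BΛ.obj Y) (r : T.ΦR.obj Y),
      T.divΛ Y b = Algebra.GrothendieckGroup.of r → b ∈ T.FΛ Y)
    (hNZ₁ : ∀ A : Dᵒᵖ, ∃ u : (T.BΛ.obj (C₁.baseOp A) : Type w) × Algebra.GrothendieckGroup (C₁.Φ.carrier A),
      u ∈ C₁.cnstFn A ∧ ∃ Z : C₁.Φ.carrier A, Z ≠ 1 ∧ u.2 = Algebra.GrothendieckGroup.of Z)
    (hQ₁ : ∀ (W : D) (𝔮 : Primes (Perfection (C₁.divisorMonoid.obj (op W)))),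
      IsQMonoprime (PfAt (C₁.divisorMonoid.obj (op W)) 𝔮))
    (hFinv₁ : ∀ (Y : D₀ᵒᵖ) (b : T.BΛ.obj Y), b ∈ T.FΛ Y → ∃ b' ∈ T.FΛ Y, b' * b = 1)
    (hP34Λ₂ : ∀ (Y : D₀'ᵒᵖ) (b : T'.BΛ.obj Y) (r : T'.ΦR.obj Y),
      T'.divΛ Y b = Algebra.GrothendieckGroup.of r → b ∈ T'.FΛ Y)
    (hNZ₂ : ∀ A : D'ᵒᵖ, ∃ u : (T'.BΛ.obj (C₂.baseOp A) : Type w) × Algebra.GrothendieckGroup (C₂.Φ.carrier A),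
      u ∈ C₂.cnstFn A ∧ ∃ Z : C₂.Φ.carrier A, Z ≠ 1 ∧ u.2 = Algebra.GrothendieckGroup.of Z)
    (hQ₂ : ∀ (W : D') (𝔮 : Primes (Perfection (C₂.divisorMonoid.obj (op W)))),
      IsQMonoprime (PfAt (C₂.divisorMonoid.obj (op W)) 𝔮))
    (hFinv₂ : ∀ (Y : D₀'ᵒᵖ) (b : T'.BΛ.obj Y), b ∈ T'.FΛ Y → ∃ b' ∈ T'.FΛ Y, b' * b = 1) :
    Literature.AnabelianGeometry.EtaleTheta.Cor38_ii
      (fun E _ Φ => ∀ (A : E) (α : Aut (Over.forget A)),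
        (∀ (B : Over A) (x : Φ.obj (op B.left)),
          Literature.AlgebraicGeometry.Frobenioids.pull Φ (α.hom.app B) x = x) → α = 1) h :=
  h.cor38_ii_weak_of_coord (C₁.isFrobenioid_treeCatVocab_of_isMonoidOn hBmon₁)
    (C₂.isFrobenioid_treeCatVocab_of_isMonoidOn hBmon₂) hP34Λ₁ hNZ₁ hQ₁ hFinv₁ hP34Λ₂ hNZ₂ hQ₂ hFinv₂

end TreeCatVocabWeak

end Cor38Hyp

end Literature.AnabelianGeometry.EtaleTheta
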